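import Mathlib

/-!
# `MatrixDescartes` census — rank-one `(2,K)₁`, lone letter: THE CUBIC MOMENT INEQUALITY FOR ANY NUMBER OF ATOMS

HONEST FRAMING.  Object-search cell `pub-symmetroid`, seat `val-sym-mdr-p1` (generation 24); helper file `--supports` the crux item
stmt-ValiantsHypothesis-18050 (`Theses.LacunarySymmetroid.MatrixDescartes`, OPEN, on HOLD) with NO closure claim.  PURE ALGEBRA over a finite
family of reals: the ALL-`K` form of `…CriticalWindowsFourCubicMoment.cubicMoment_pos` (generation 23, four atoms), i.e. the abstract
inequality «`E U³ > 3E[U R²]`» to which the fastest-lone-letter law reduces at a fold point (memo MOMENT-FOLD.md §5, §7).  The four-atom file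
proved the ORDER-polytope step (R′) by a vertex analysis of a concave quadratic on a triangle — the one `K`-specific ingredient of the
`K = 4` law (memo §7, remark (ii)).  Here that step is replaced by a TERMWISE decomposition valid for any number of atoms, so the whole
inequality holds for an arbitrary finite index set.  Nothing here bears on `MatrixDescartes` in its window, on `DoorA26`/`DoorA34`,
registers / credences, or `VP ≠ VNP`; no count is claimed in this file.

THE STATEMENT (`cubicMoment_pos`).  Atoms `m ∈ s` (a `Finset`) with masses `dₘ > 0` and two real «random variables» `U`, `R` with
`E U = E R = E[UR] = 0` (`E` = the `d`-weighted sum); a PIVOT atom `p`, all other atoms `Uₘ < 0`, and a LONE atom `j ≠ p`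
with `Uⱼ ≤ Uₘ` for all `m` (the most negative); with `gₘ := Uₘ + Rₘ`, the LEFT atoms `m ∉ {p, j}` (at least one) satisfy
`0 ≤ gₘ ≤ gₚ` (positivity and ORDER) and the GAP `E U² − E R² < (∑d)·gₘ²`.  Then `E[U³] > 3·E[U R²]`.
(In the application — companion `…LoneFoldAlgebra` — `dₘ = Wₘ(T−tₘ)²`, `U = S_{βg}·β`, `R = (S₂(T+tₘ) − S_{βg}βₘ(T−tₘ))/(T−tₘ)`,
`gₘ = S₂·(T+tₘ)/(T−tₘ)`; GAP is the fold relation plus `tₘ > 0`, ORDER is `tₘ ≤ tₚ`, «`j` most negative» is «lone letter fastest».)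

THE PROOF (three lines, all `K`).
(Q) `mixedCubic_nonpos`: `E[U R²] ≤ 0`.  The `(−dU)`-weighted mean of `R` over the non-pivot atoms is `Rₚ` (by `E U = E[UR] = 0`), so
  `0 ≤ ∑ₘ (−dₘUₘ)(Rₘ − Rₚ)² = −E[UR²] + 2Rₚ·E[UR] − Rₚ²·E U = −E[UR²]`.
(R′) `orderPolytope_nonneg`: with `cₘ := dₘ(Uₘ − Uⱼ) ≥ 0` and any `G` with `0 ≤ G ≤ gₘ ≤ gₚ` on the left atoms, using the linear relation
  `∑ cₘRₘ = 0` (`orderPolytope_identity`):  `∑ₘ cₘ(gₘ(2Uₘ − gₘ) − G²) = cₚ(gₚ² − G²) + ∑_{left} cₘ[(gₘ − G)(gₘ + G) + 2gₘ(gₚ − gₘ) + 2(−Uₘ)(gₚ − gₘ)]`,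
  every bracket non-negative — NO vertex analysis.
ASSEMBLY: `∑ₘ cₘ gₘ(2Uₘ − gₘ) = E U³ − E[UR²] − Uⱼ(E U² − E R²)`, so with `G = g_{m*}` (a left atom minimising `g`) and the GAP at `m*`:
  `E U³ − E[UR²] ≥ |Uⱼ|·((∑d)G² − (E U² − E R²)) > 0`; hence `E U³ − 3E[UR²] = 3(E U³ − E[UR²]) − 2E U³ > 0` if `E U³ ≤ 0`, and
  `≥ E U³ > 0` otherwise by (Q).
[folklore] Weighted variance is non-negative; sign bookkeeping over a `Finset`.  No definitions, no named facts.
-/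

-- `Summit.ValiantsHypothesis.ValiantsHypothesis.…` repeats a component by the D-0017 layout
-- (single-conjunct summit), which the `dupNamespace` linter flags; the name is mandated.
set_option linter.dupNamespace false

namespace Summit.ValiantsHypothesis.ValiantsHypothesis.Theorems.LacunarySymmetroidMatrixDescartes.Pivot.CriticalWindows.Lone

open Finset
open scoped BigOperators

/-! ## 1. (Q) The mixed cubic moment is nonpositive -/

/-- **`E[U R²] ≤ 0` (any number of atoms).**  If the masses are non-negative, every atom other than the pivot `p` has `U ≤ 0`, and
`E U = E[UR] = 0`, then `∑ dₘUₘRₘ² ≤ 0`: the `(−dU)`-weighted variance of `R` about `Rₚ` is `−E[UR²]`. [folklore] -/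
theorem mixedCubic_nonpos {ι : Type*} (s : Finset ι) (d U R : ι → ℝ) (p : ι)
    (hd : ∀ m ∈ s, 0 ≤ d m) (hU : ∀ m ∈ s, m ≠ p → U m ≤ 0)
    (hEU : ∑ m ∈ s, d m * U m = 0) (hEUR : ∑ m ∈ s, d m * U m * R m = 0) :
    ∑ m ∈ s, d m * U m * R m ^ 2 ≤ 0 := by
  have hterm : ∀ m ∈ s, (-(d m * U m)) * (R m - R p) ^ 2
      = -(d m * U m * R m ^ 2) + 2 * R p * (d m * U m * R m) - R p ^ 2 * (d m * U m) := by
    intro m _; ring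
  have key : ∑ m ∈ s, (-(d m * U m)) * (R m - R p) ^ 2 = -(∑ m ∈ s, d m * U m * R m ^ 2) := by
    rw [Finset.sum_congr rfl hterm, Finset.sum_sub_distrib, Finset.sum_add_distrib, Finset.sum_neg_distrib,
      ← Finset.mul_sum, ← Finset.mul_sum, hEU, hEUR]
    ring
  have hnn : 0 ≤ ∑ m ∈ s, (-(d m * U m)) * (R m - R p) ^ 2 := by
    refine Finset.sum_nonneg fun m hm => ?_
    by_cases hmp : m = p
    · rw [hmp, sub_self]; simp
    · have : 0 ≤ -(d m * U m) := by
        have := mul_nonpos_of_nonneg_of_nonpos (hd m hm) (hU m hm hmp)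
        linarith
      exact mul_nonneg this (sq_nonneg _)
  linarith

/-! ## 2. (R′) The order-polytope step, termwise -/

/-- **REWRITING BY THE LINEAR RELATION.**  For any coefficients `c`, values `g, U`, a level `G` and a reference value `gp`: if
`∑ cₘ(gₘ − Uₘ) = 0` then `∑ cₘ(gₘ(2Uₘ − gₘ) − G) = ∑ cₘ((2·gp·gₘ − gₘ² − G) − 2Uₘ(gp − gₘ))` (the two sides differ by
`2·gp·∑ cₘ(gₘ − Uₘ)`). [folklore] -/
theorem orderPolytope_identity {ι : Type*} (s : Finset ι) (c g U : ι → ℝ) (G gp : ℝ)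
    (h : ∑ m ∈ s, c m * (g m - U m) = 0) :
    ∑ m ∈ s, c m * (g m * (2 * U m - g m) - G)
      = ∑ m ∈ s, c m * ((2 * gp * g m - g m ^ 2 - G) - 2 * U m * (gp - g m)) := by
  have hterm : ∀ m ∈ s, c m * ((2 * gp * g m - g m ^ 2 - G) - 2 * U m * (gp - g m))
      = c m * (g m * (2 * U m - g m) - G) + 2 * gp * (c m * (g m - U m)) := by
    intro m _; ring
  rw [Finset.sum_congr rfl hterm, Finset.sum_add_distrib, ← Finset.mul_sum, h]
  ring

/-- **THE ORDER-POLYTOPE STEP (any number of atoms).**  Coefficients `cₘ ≥ 0` with `cⱼ = 0`; values `gₘ`, `Uₘ` with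
`∑ cₘ(gₘ − Uₘ) = 0`; a level `G ≥ 0` with `G ≤ gₚ`, and on every atom other than `p, j`: `G ≤ gₘ ≤ gₚ` and `Uₘ ≤ 0`.  Then
`0 ≤ ∑ cₘ(gₘ(2Uₘ − gₘ) − G²)`.  Termwise after `orderPolytope_identity`: the `p`-term is `cₚ(gₚ² − G²)`, the `j`-term vanishes, and a
left term is `cₘ[(gₘ − G)(gₘ + G) + 2gₘ(gₚ − gₘ) + 2(−Uₘ)(gₚ − gₘ)]`. [folklore] -/
theorem orderPolytope_nonneg {ι : Type*} (s : Finset ι) (c g U : ι → ℝ) (G : ℝ) (p j : ι)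
    (hc : ∀ m ∈ s, 0 ≤ c m) (hcj : c j = 0) (hG : 0 ≤ G) (hGp : G ≤ g p)
    (hleft : ∀ m ∈ s, m ≠ p → m ≠ j → G ≤ g m ∧ g m ≤ g p ∧ U m ≤ 0)
    (h : ∑ m ∈ s, c m * (g m - U m) = 0) :
    0 ≤ ∑ m ∈ s, c m * (g m * (2 * U m - g m) - G ^ 2) := by
  rw [orderPolytope_identity s c g U (G ^ 2) (g p) h]
  refine Finset.sum_nonneg fun m hm => ?_
  by_cases hmp : m = p
  · rw [hmp]
    have e : c p * ((2 * g p * g p - g p ^ 2 - G ^ 2) - 2 * U p * (g p - g p)) = c p * ((g p - G) * (g p + G)) := by ring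
    rw [e]
    exact mul_nonneg (hc p (hmp ▸ hm)) (mul_nonneg (by linarith) (by linarith))
  · by_cases hmj : m = j
    · rw [hmj, hcj, zero_mul]
    · obtain ⟨h1, h2, h3⟩ := hleft m hm hmp hmj
      have e : c m * ((2 * g p * g m - g m ^ 2 - G ^ 2) - 2 * U m * (g p - g m))
          = c m * ((g m - G) * (g m + G) + 2 * g m * (g p - g m) + 2 * (-U m) * (g p - g m)) := by ring
      rw [e]
      refine mul_nonneg (hc m hm) ?_
      have t1 : 0 ≤ (g m - G) * (g m + G) := mul_nonneg (by linarith) (by linarith)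
      have t2 : 0 ≤ 2 * g m * (g p - g m) := mul_nonneg (by linarith) (by linarith)
      have t3 : 0 ≤ 2 * (-U m) * (g p - g m) := mul_nonneg (by linarith) (by linarith)
      linarith

/-! ## 3. The cubic moment inequality -/

/-- The assembly identity `∑ dₘ(Uₘ − Uⱼ)·gₘ(2Uₘ − gₘ) = E U³ − E[UR²] − Uⱼ(E U² − E R²)` for `gₘ = Uₘ + Rₘ`. [folklore] -/
theorem assembly_identity {ι : Type*} (s : Finset ι) (d U R : ι → ℝ) (j : ι) :
    ∑ m ∈ s, d m * (U m - U j) * ((U m + R m) * (2 * U m - (U m + R m)))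
      = (∑ m ∈ s, d m * U m ^ 3) - (∑ m ∈ s, d m * U m * R m ^ 2)
        - U j * ((∑ m ∈ s, d m * U m ^ 2) - ∑ m ∈ s, d m * R m ^ 2) := by
  have hterm : ∀ m ∈ s, d m * (U m - U j) * ((U m + R m) * (2 * U m - (U m + R m)))
      = d m * U m ^ 3 - d m * U m * R m ^ 2 - U j * (d m * U m ^ 2 - d m * R m ^ 2) := by
    intro m _; ring
  rw [Finset.sum_congr rfl hterm, Finset.sum_sub_distrib, Finset.sum_sub_distrib, ← Finset.mul_sum, Finset.sum_sub_distrib]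

/-- **THE CUBIC MOMENT INEQUALITY (any number of atoms).**  See the module docstring: masses `d > 0`; `E U = E R = E[UR] = 0`; all atoms
other than the pivot `p` have `U < 0`; the lone atom `j ≠ p` has `Uⱼ ≤ Uₘ` for every `m` (so `Uₚ ≥ Uⱼ`; positivity of `Uₚ` is not even
needed); left atoms (`m ≠ p, j`, at least one) with `0 ≤ gₘ ≤ gₚ` and the GAP `E U² − E R² < (∑d)·gₘ²` (`g = U + R`).  Then
`E[U³] > 3E[U R²]`. [folklore] -/
theorem cubicMoment_pos {ι : Type*} (s : Finset ι) (d U R : ι → ℝ) (p j : ι)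
    (hp : p ∈ s) (hj : j ∈ s) (hpj : p ≠ j) (hleft : ∃ m ∈ s, m ≠ p ∧ m ≠ j)
    (hd : ∀ m ∈ s, 0 < d m) (hUneg : ∀ m ∈ s, m ≠ p → U m < 0) (hUj : ∀ m ∈ s, U j ≤ U m)
    (hEU : ∑ m ∈ s, d m * U m = 0) (hER : ∑ m ∈ s, d m * R m = 0) (hEUR : ∑ m ∈ s, d m * U m * R m = 0)
    (hgpos : ∀ m ∈ s, m ≠ p → m ≠ j → 0 ≤ U m + R m)
    (horder : ∀ m ∈ s, m ≠ p → m ≠ j → U m + R m ≤ U p + R p)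
    (hgap : ∀ m ∈ s, m ≠ p → m ≠ j →
      (∑ n ∈ s, d n * U n ^ 2) - (∑ n ∈ s, d n * R n ^ 2) < (∑ n ∈ s, d n) * (U m + R m) ^ 2) :
    0 < (∑ m ∈ s, d m * U m ^ 3) - 3 * (∑ m ∈ s, d m * U m * R m ^ 2) := by
  classical
  have hUjneg : U j < 0 := hUneg j hj hpj.symm
  -- (Q)
  have hQ := mixedCubic_nonpos s d U R p (fun m hm => (hd m hm).le) (fun m hm hmp => (hUneg m hm hmp).le) hEU hEUR
  -- a left atom minimising `g = U + R` over the left atoms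
  set L : Finset ι := (s.erase p).erase j with hL
  have hLmem : ∀ m, m ∈ L ↔ m ∈ s ∧ m ≠ p ∧ m ≠ j := by
    intro m
    rw [hL, Finset.mem_erase, Finset.mem_erase]
    tauto
  have hLne : L.Nonempty := by
    obtain ⟨m, hm, hmp, hmj⟩ := hleft
    exact ⟨m, (hLmem m).mpr ⟨hm, hmp, hmj⟩⟩
  obtain ⟨mstar, hmstarL, hmin⟩ := Finset.exists_min_image L (fun m => U m + R m) hLne
  obtain ⟨hms, hmsp, hmsj⟩ := (hLmem mstar).mp hmstarL
  set G : ℝ := U mstar + R mstar with hGdef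
  have hG0 : 0 ≤ G := hgpos mstar hms hmsp hmsj
  have hGp : G ≤ U p + R p := horder mstar hms hmsp hmsj
  -- (R′) with `cₘ = dₘ(Uₘ − Uⱼ)`, `gₘ = Uₘ + Rₘ`
  have hlin : ∑ m ∈ s, d m * (U m - U j) * ((U m + R m) - U m) = 0 := by
    have hterm : ∀ m ∈ s, d m * (U m - U j) * ((U m + R m) - U m) = d m * U m * R m - U j * (d m * R m) := by
      intro m _; ring
    rw [Finset.sum_congr rfl hterm, Finset.sum_sub_distrib, ← Finset.mul_sum, hEUR, hER]
    ring
  have hF := orderPolytope_nonneg s (fun m => d m * (U m - U j)) (fun m => U m + R m) U G p j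
    (fun m hm => mul_nonneg (hd m hm).le (by linarith [hUj m hm])) (by simp) hG0 hGp
    (fun m hm hmp hmj => ⟨hmin m ((hLmem m).mpr ⟨hm, hmp, hmj⟩), horder m hm hmp hmj, (hUneg m hm hmp).le⟩) hlin
  -- the constant `∑ cₘ = (∑ d)·|Uⱼ|`
  have hC : ∑ m ∈ s, d m * (U m - U j) = -(U j) * ∑ m ∈ s, d m := by
    have hterm : ∀ m ∈ s, d m * (U m - U j) = d m * U m - U j * d m := by intro m _; ring
    rw [Finset.sum_congr rfl hterm, Finset.sum_sub_distrib, ← Finset.mul_sum, hEU]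
    ring
  -- split `∑ cₘ(gₘ(2Uₘ−gₘ) − G²) = ∑ cₘ gₘ(2Uₘ−gₘ) − G²·∑ cₘ`
  have hsplit : ∑ m ∈ s, d m * (U m - U j) * ((U m + R m) * (2 * U m - (U m + R m)) - G ^ 2)
      = (∑ m ∈ s, d m * (U m - U j) * ((U m + R m) * (2 * U m - (U m + R m)))) - G ^ 2 * ∑ m ∈ s, d m * (U m - U j) := by
    have hterm : ∀ m ∈ s, d m * (U m - U j) * ((U m + R m) * (2 * U m - (U m + R m)) - G ^ 2)
        = d m * (U m - U j) * ((U m + R m) * (2 * U m - (U m + R m))) - G ^ 2 * (d m * (U m - U j)) := by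
      intro m _; ring
    rw [Finset.sum_congr rfl hterm, Finset.sum_sub_distrib, ← Finset.mul_sum]
  have hF' : 0 ≤ ∑ m ∈ s, d m * (U m - U j) * ((U m + R m) * (2 * U m - (U m + R m)) - G ^ 2) := by
    simpa using hF
  rw [hsplit, assembly_identity s d U R j, hC] at hF'
  -- the GAP slack at `mstar`
  have hslack := hgap mstar hms hmsp hmsj
  have hM : 0 < ∑ m ∈ s, d m := Finset.sum_pos hd ⟨p, hp⟩
  -- `E U³ − E[UR²] ≥ |Uⱼ|·slack > 0`
  have hpos1 : 0 < (∑ m ∈ s, d m * U m ^ 3) - (∑ m ∈ s, d m * U m * R m ^ 2) := by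
    have : 0 < (-(U j)) * ((∑ n ∈ s, d n) * (U mstar + R mstar) ^ 2
        - ((∑ n ∈ s, d n * U n ^ 2) - (∑ n ∈ s, d n * R n ^ 2))) := mul_pos (by linarith) (by linarith)
    nlinarith
  by_cases h3 : 0 < ∑ m ∈ s, d m * U m ^ 3
  · linarith
  · linarith

end Summit.ValiantsHypothesis.ValiantsHypothesis.Theorems.LacunarySymmetroidMatrixDescartes.Pivot.CriticalWindows.Lone
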